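import Summits.Ventures.PercRepro.S1FiveCircuitBase
import Summits.Ventures.PercRepro.TriangleCapEightI
import Summits.Ventures.PercRepro.S1CellCaps5

/-!
# PercRepro — THE CELL `(10, 10)`: an `e`-free core of rank `10` with `20` points satisfies `RLS` at level `4`
(p2, gen 20; SUBCLAIM-S1 §6.4)

The three-cap cell inequality `cellOK14 10 10 20 216 1518` holds by kernel: `s₃ ≤ cq3 10 = 20` (p3's exact
`P(10) = 20`, TriangleCapEightI — the cell needs it: with LEMMA Q‴'s `21` it reads `1.0125`), `s₄ ≤ avgChain 10 = 216`
(S1CoreCapChain) and `s₅ ≤ avgChain5b 10 = 1518` (S1FiveCircuitBase — the chain restarted from `s₅ ≤ 52` at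
nullity `4`; the cell needs `≤ 1544`, the chain from the crude base gave `1638`). Exact-rational twin `0.9968`
(mining/p2/g20). The row `p = 10` of the `q = 4` window now ends at `(10, 9)`.

* `cell_ten_ten_chains` — `cellOK14 10 10 20 216 1518 = true` (decide + kernel);
* **`c025_core_ten_ten`** — the cell.
Axioms: standard.
-/

open scoped Matroid

namespace PercRepro

namespace S1

open Set

variable {α : Type}

/-- The capped cell `(10, 10)` with `s₃ ≤ 20`, `s₄ ≤ 216`, `s₅ ≤ 1518`, by kernel. -/
theorem cell_ten_ten_chains : cellOK14 10 10 20 216 1518 = true := by decide +kernel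

/-- The chain value `avgChain 10 = 216`. -/
theorem avgChain_ten : avgChain 10 = 216 := by decide

/-- **THE CELL `(10, 10)`**: an `e`-free core of rank `10` with `20` points satisfies `RLS` at level `4`. -/
theorem c025_core_ten_ten (M : Matroid α) [M.Finite] (hR : M.eRank = (10 : ℕ)) (hn : M.E.ncard = 20)
    (hfree : ∀ e ∈ M.E, ∃ A ⊆ M.E \ {e}, e ∉ M.closure A ∧ e ∉ M.closure ((M.E \ {e}) \ A)) :
    ThmN.RLS M 10 4 := by
  have hd : M.E.encard = M.eRank + ((10 : ℕ) : ℕ∞) := by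
    rw [hR, ← M.ground_finite.cast_ncard_eq, hn]
    push_cast
    ring
  have hP : {C : Set α | M.IsCircuit C ∧ C.ncard = 3}.ncard ≤ 20 := by
    have h := TriangleCap.core_ncard_triangles_le_cq3 M hfree hd
    rwa [show TriangleCap.cq3 10 = 20 by decide] at h
  have hS : {C : Set α | M.IsCircuit C ∧ C.ncard = 4}.ncard ≤ 216 := by
    have h := ncard_fourCircuits_le_avgChain 10 M hfree hd
    rwa [avgChain_ten] at h
  have hS5 : {C : Set α | M.IsCircuit C ∧ C.ncard = 5}.ncard ≤ 1518 :=
    ncard_fiveCircuits_le_avgChain5b_ten M hfree (by exact_mod_cast hd)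
  exact rls_of_cellOK14 M 10 10 20 216 1518 (by norm_num) hR hn hfree hP hS hS5 (by norm_num)
    cell_ten_ten_chains

end S1

end PercRepro
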